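/-
Copyright (c) 2026 the pub-hodgecm-mathlib formalisation cell (harness21).  Prover seat hodgecm-mathlib-LH4-p06 (g5), Track A «(D-RAM) FOUR-FRAME», unit U2H, census leaf
(ρ2b′-X) `stub_U2H_fixedPointCensus_typeTwo_unit0` — T5c «TORIC LEVEL CENSUS, M∕E-RAMIFIED»: (D3-LAW) the SIDE STRUCTURE of the top bit — the two even classes
(translator class T on `+`, non-norm class E on `−`), the non-norm threshold, exclusivity and constancy along the diagonal (LH4-p04 (g4)'s T5s-RamM letter
`… ∧ (k′ ≤ dΘ − 2 ∨ side = ε)`).  2026-09-04.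
-/
import Summits.HodgeConjecture.HodgeConjecture.Theorems.F0P3cDyRamToricLevelCensusRamMTopLaw   -- ★ (this seat): LAW-i `exists_thetaFixed_normOne_near_iff_ramified`; brings ★ TopBit, ★ p857465
import HarnessLib

/-!
# T5c (D3-LAW): the side structure of the RamM top bit — classes T ∕ E, the threshold `k + 2 ≤ dΘ`, exclusivity and constancy

Cell `hodgecm-mathlib` (D-0151), FLOOR 0, crux H413 = `stmt-HodgeConjecture-24833`; squad F0∕P3c∕LH4; lane `--supports stmt-HodgeConjecture-24833 --as helper` (count-neutral).
THEOREMS ONLY (no `def`, no instance, no notation, no `sorry`, default heartbeats).  Socket served: the second conjunct `k′ + 2 ≤ 2g ∨ ε = side` of LH4-p04 (g4)'s T5s-RamM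
`hvTop` (★ p857711) for the (D3) bit of ★ p857665.  Letters (one field `M`): `κ := ρμ∕μ`; `t(ω) := ρ(ωΘω)∕(ωΘω)`; `ψ(y) := ρy∕y`; a radius `r`;
CLASS T at radius `r` := `∃ ω ∈ U_M, |κ·t(ω) − 1| ≤ r` (= the (D3) bit under an exact unit translator, ★ `topBit_iff_exists_isOrd_of_translator` + §0);
CLASS E := `∃ ω ∈ U_M, |κ·ψ(n₀)·t(ω) − 1| ≤ r`, `n₀` a `Θ`-fixed unit NON-norm (= the anchored bit, ★ `topBit_iff_exists_isOrd_of_anchor` + §0);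
NEAR `T♮` := `∃ x, Θx = x ∧ xρx = 1 ∧ |κ − x| ≤ r` (decided by ★ LAW-i).
* §0 `isOrd_mul_norm_iff_twist_ramified` — the ★ `IsOrd` currency of the bit IS the class-T∕E inequality (`|ρ(μN) − μN| = |μ|·|κt − 1|`).
* §1 `exists_thetaFixed_normOne_near_of_twist` — classes T and E lie near `T♮` (`x := y∕ρy`, `y = n₀·N(ω)`).
* §2 **`twist_near_or_anchored_of_thetaFixed_near`** — conversely, near `T♮` (at a radius `≤ exp(−2d′)` with `|κ − 1| ≤ exp(−2d′)`) means class T OR class E: Hilbert 90 with a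
  unit on the third field (★ `exists_unit_eq_div_map` transported along `jK`) and the norm dichotomy of index two (★ `exists_nonnorm_dichotomy` on the `Θ`-datum).
* §3 THE THRESHOLD (★ p857465 §2): **`anchored_twist_near_iff_lt_threshold`** — `(∃ ω, |ψ(n₀)t(ω) − 1| ≤ |jK π′^{d′+k}|) ⟺ k + 2 ≤ dΘ`; hence
  **`not_twist_near_and_anchored_of_threshold_le`** (beyond the threshold the classes T and E EXCLUDE each other), **`twist_near_iff_anchored_of_lt_threshold`** (below it they
  AGREE), and **`twist_near_of_twist_near_of_near`** ∕ **`anchored_of_anchored_of_near`** (CONSTANCY: beyond the threshold the class that is alive at one radius is the class alive at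
  every deeper radius where `κ` is still near `T♮`) — the content of «one-sided far cells live on ONE side ε, the same along the diagonal».
HONEST LABEL.  Count-neutral (`--supports`); unconditional local algebra; WHICH side `ε` is (the Hilbert-symbol identification, MAP seam S9-R) is not asserted here; nothing of
(ρ2b′-X) is asserted — `HC_CM` is proved only modulo the 7 printed citations (2 remaining named inputs: hLiu418 = `stmt-HodgeConjecture-24832`, h413 = `stmt-HodgeConjecture-24833`)
until rung 0 closes.

## References
* [Serre1979] J.-P. Serre, *Local Fields*, GTM 67 (1979): Ch. V §3 Cor. 3 (norm subgroups of index two), Ch. X §1 (Hilbert 90).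
* [Jacobowitz1962] R. Jacobowitz, *Hermitian forms over local fields*, Amer. J. Math. 84 (1962): §4 (norm classes).
* [Flicker1998UnitaryFL] Y. Z. Flicker, *Elementary proof of the fundamental lemma for a unitary group*, Canad. J. Math. 50 (1998): p. 84.
-/

set_option autoImplicit false

noncomputable section

namespace Summit.HodgeConjecture.HodgeConjecture.Cruxes.H413.F0P3cDyRamToricLevelCensusRamM

open WithZero IsLocalRing
open scoped Valued
open Literature.NumberTheory.Automorphic.UnitaryThreeFourFrame (IsRamifiedQuadraticDatum)
open Literature.NumberTheory.LocalFields.QuadraticOrder Literature.NumberTheory.LocalFields.WildQuadraticDatum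
open Summit.HodgeConjecture.HodgeConjecture.Cruxes.H413.F0P3cDyRamToricCensusDefs

variable {K : Type} [Field K] [Valued K ℤᵐ⁰] {ρ Θ : K →+* K} {α ϖE : K} {dρ t : ℕ}
variable {K' : Type*} [Field K'] [Valued K' ℤᵐ⁰] {σ' : K' →+* K'} {π' : K'} {d' : ℕ}

/-! ## §0 The `IsOrd` currency of the bit is the class inequality -/

/-- **`IsOrd ρ α (ϖE^{j+a}) (μ·ωΘω) ⟺ |κ·t(ω) − 1| ≤ exp(2m − 2a − 2j − d_ρ)`** (`κ = ρμ∕μ`, `|μ| = |ϖE|^m`, `|ω| = 1`; `|ρ(μN) − μN| = |μ|·|κt − 1|`, integrality is automatic).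
[cite: Jacobowitz1962, §4] [cite: Flicker1998UnitaryFL, p. 84] -/
theorem isOrd_mul_norm_iff_twist_ramified (hD : IsRamifiedQuadraticDatum ρ α dρ t) (hvΘ : ∀ x, Valued.v (Θ x) = Valued.v x)
    (hϖE : Valued.v ϖE = exp (-2 : ℤ)) {μ : K} {m : ℕ} (hμ : Valued.v μ = Valued.v ϖE ^ m) (j a : ℕ) {ω : K} (hω : Valued.v ω = 1) :
    IsOrd ρ α (ϖE ^ (j + a)) (μ * (ω * Θ ω)) ↔
      Valued.v (ρ μ / μ * (ρ (ω * Θ ω) / (ω * Θ ω)) - 1) ≤ exp (2 * (m : ℤ) - 2 * a - 2 * j - dρ) := by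
  have hμ0 : μ ≠ 0 := fun h0 => by
    rw [h0, map_zero, v_varpiE_pow hϖE] at hμ; exact exp_ne_zero hμ.symm
  have hvμ0 : 0 < Valued.v μ := zero_lt_iff.2 ((Valuation.ne_zero_iff _).2 hμ0)
  have hcond : Valued.v (ϖE ^ (j + a) * (α - ρ α)) = Valued.v μ * exp (2 * (m : ℤ) - 2 * a - 2 * j - dρ) := by
    rw [v_conductorR (ρ := ρ) (v_sub_map_eq_exp_of_datum hD) hϖE (j + a), hμ, v_varpiE_pow hϖE, ← exp_add]
    congr 1; push_cast; ring
  have hint : Valued.v (μ * (ω * Θ ω)) ≤ 1 := by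
    rw [map_mul, map_mul, hvΘ, hω, mul_one, mul_one, hμ, v_varpiE_pow hϖE, ← exp_zero, exp_le_exp]; omega
  rw [IsOrd, Valuation.map_sub_swap, v_map_mul_norm_sub_eq hvΘ hμ0 hω, hcond]
  exact ⟨fun h => le_of_mul_le_mul_left h.2 hvμ0, fun h => ⟨hint, mul_le_mul_right h _⟩⟩

/-! ## §1 Classes T and E lie near `T♮` -/

/-- **A TWISTED APPROXIMANT IS A `T♮`-APPROXIMANT**: if `Θy = y`, `y ≠ 0` and `|κ·(ρy∕y) − 1| ≤ r` then `x := y∕ρy` is `Θ`-fixed with `xρx = 1` and `|κ − x| ≤ r`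
(`y = ωΘω` for class T, `y = n₀·ωΘω` for class E). [cite: Serre1979, Ch. V §3] -/
theorem exists_thetaFixed_normOne_near_of_twist (hρρ : ∀ x, ρ (ρ x) = x) (hvρ : ∀ x, Valued.v (ρ x) = Valued.v x) (hΘρ : ∀ x, Θ (ρ x) = ρ (Θ x))
    {κ y : K} (hΘy : Θ y = y) (hy0 : y ≠ 0) {r : ℤᵐ⁰} (h : Valued.v (κ * (ρ y / y) - 1) ≤ r) :
    ∃ x : K, Θ x = x ∧ x * ρ x = 1 ∧ Valued.v (κ - x) ≤ r := by
  have hρy0 : ρ y ≠ 0 := (map_ne_zero ρ).2 hy0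
  refine ⟨y / ρ y, by rw [map_div₀, hΘρ, hΘy], by rw [map_div₀, hρρ]; field_simp, ?_⟩
  have h1 : κ - y / ρ y = y / ρ y * (κ * (ρ y / y) - 1) := by field_simp
  rw [h1, map_mul, map_div₀, hvρ, div_self ((Valuation.ne_zero_iff _).2 hy0), one_mul]
  exact h

/-! ## §2 Near `T♮` means class T or class E -/

/-- **NEAR `T♮` ⇒ CLASS T OR CLASS E.**  Frame: the third field `K′` (datum `(σ′, π′, d′)`) embedded order-compatibly by `jK` onto the `Θ`-fixed elements (`jK∘σ′ = ρ∘jK`,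
`|jK π′| = exp(−2)`), the `Θ`-datum `(M, Θ, ϖ, dΘ, tΘ)` over a complete field with finite residue field, and a `Θ`-fixed unit NON-norm `n₀`.  If `x ∈ T♮` with `|κ − x| ≤ r`
and `|x − 1| ≤ exp(−2d′)` (the unit coset of `T♮`), then `κ` is in class T or in class E at radius `r`: `x = b∕ρb` for a `Θ`-fixed UNIT `b` (★ Hilbert 90 with a unit on `K′`),
and `b = N(ω)` or `b = n₀·N(ω)` (★ norm dichotomy of index two). [cite: Serre1979, Ch. X §1] [cite: Serre1979, Ch. V §3 Cor. 3] -/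
theorem twist_near_or_anchored_of_thetaFixed_near [CompleteSpace K] [Finite 𝓀[K]]
    (hvρ : ∀ x, Valued.v (ρ x) = Valued.v x) (hvΘ : ∀ x, Valued.v (Θ x) = Valued.v x)
    (hσ' : ∀ x, σ' (σ' x) = x) (hvσ' : ∀ x, Valued.v (σ' x) = Valued.v x) (hfix' : ∀ x : K', σ' x = x → x ≠ 0 → ∃ n : ℤ, Valued.v x = exp (2 * n))
    (hπ' : Valued.v π' = exp (-1 : ℤ)) (hdd' : Valued.v (π' - σ' π') = Valued.v π' ^ d')
    (jK : K' →+* K) (hjle : ∀ x y : K', Valued.v (jK x) ≤ Valued.v (jK y) ↔ Valued.v x ≤ Valued.v y) (hjΘ : ∀ x, Θ (jK x) = jK x)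
    (hjfix : ∀ z : K, Θ z = z → ∃ x, jK x = z) (hjσ : ∀ x, jK (σ' x) = ρ (jK x)) (hjπ : Valued.v (jK π') = exp (-2 : ℤ))
    {ϖ : K} {dΘ tΘ : ℕ} (hDΘ : IsRamifiedQuadraticDatum Θ ϖ dΘ tΘ)
    {n₀ : K} (hΘn₀ : Θ n₀ = n₀) (hn₀1 : Valued.v n₀ = 1) (hn₀N : ¬ ∃ z : K, z * Θ z = n₀)
    {κ x : K} (hΘx : Θ x = x) (hx : x * ρ x = 1) {r : ℤᵐ⁰} (hκx : Valued.v (κ - x) ≤ r) (hx1 : Valued.v (x - 1) ≤ exp (-(2 * (d' : ℤ)))) :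
    (∃ ω : K, Valued.v ω = 1 ∧ Valued.v (κ * (ρ (ω * Θ ω) / (ω * Θ ω)) - 1) ≤ r) ∨
      ∃ ω : K, Valued.v ω = 1 ∧ Valued.v (κ * (ρ n₀ / n₀) * (ρ (ω * Θ ω) / (ω * Θ ω)) - 1) ≤ r := by
  have hd1 := one_le_of_v_sub_map_eq_pow hvσ' hπ' hdd'
  have hvx : Valued.v x = 1 := v_eq_one_of_v_mul_map_eq_one hvρ (by rw [hx]; exact Valuation.map_one _)
  -- (1) pull `x` back to `K′` and write it as `a′ ∕ σ′a′` with a unit `a′`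
  obtain ⟨x', rfl⟩ := hjfix x hΘx
  have hx' : x' * σ' x' = 1 := jK.injective (by rw [map_mul, hjσ, hx, map_one])
  have hx'1 : Valued.v (x' - 1) ≤ Valued.v π' ^ d' := by
    rw [← map_pow, ← hjle, map_sub, map_one, map_pow, map_pow, hjπ, ← exp_nsmul, nsmul_eq_mul]
    refine hx1.trans_eq ?_; congr 1; ring
  obtain ⟨a', ha'1, hxa'⟩ := exists_unit_eq_div_map hσ' hvσ' hfix' hπ' hdd' hd1 hx' hx'1
  have hΘb : Θ (jK a') = jK a' := hjΘ a'
  have hb1 : Valued.v (jK a') = 1 := (v_eq_one_iff_of_le_iff jK hjle a').2 ha'1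
  have hb0 : jK a' ≠ 0 := fun h0 => by rw [h0, map_zero] at hb1; exact zero_ne_one hb1
  have hxb : jK x' = jK a' / ρ (jK a') := by rw [hxa', map_div₀, hjσ]
  -- (2) the norm dichotomy: `jK a′ = N(ω)` or `n₀·N(ω) = jK a′`
  obtain ⟨c₀, -, hc₀N, hdich⟩ := exists_nonnorm_dichotomy hDΘ
  have hn₀0 : n₀ ≠ 0 := fun h0 => by rw [h0, map_zero] at hn₀1; exact zero_ne_one hn₀1
  -- a norm `ωΘω` with unit value has a unit `ω`
  have hunit : ∀ {ω y : K}, ω * Θ ω = y → Valued.v y = 1 → Valued.v ω = 1 := fun {ω y} hω hy =>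
    v_eq_one_of_v_mul_map_eq_one hvΘ (by rw [hω, hy])
  -- `|κ·ψ(y) − 1| = |κ − y∕ρy|` for the element `y` with `x = y∕ρy`
  have key : ∀ {y : K}, y ≠ 0 → jK x' = y / ρ y → Valued.v (κ * (ρ y / y) - 1) ≤ r := fun {y} hy0 hxy => by
    have hρy0 : ρ y ≠ 0 := (map_ne_zero ρ).2 hy0
    have h1 : κ * (ρ y / y) - 1 = (κ - y / ρ y) * (ρ y / y) := by field_simp
    rw [h1, map_mul, map_div₀, hvρ, div_self ((Valuation.ne_zero_iff _).2 hy0), mul_one, ← hxy]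
    exact hκx
  rcases hdich (jK a') hΘb hb0 with ⟨ω, hω⟩ | ⟨ω₁, hω₁⟩
  · -- `jK a′ = ωΘω`: class T
    left
    exact ⟨ω, hunit hω hb1, key (by rw [hω]; exact hb0) (by rw [hω]; exact hxb)⟩
  · -- `c₀·jK a′ = ω₁Θω₁` and `c₀n₀ = ω₂Θω₂`: `jK a′ = n₀·N(ω₁∕ω₂)`, class E
    right
    obtain ⟨ω₂, hω₂⟩ : ∃ z : K, z * Θ z = c₀ * n₀ := (hdich n₀ hΘn₀ hn₀0).resolve_left hn₀N
    have hc₀0 : c₀ ≠ 0 := fun h0 => hc₀N ⟨0, by rw [h0, zero_mul]⟩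
    have hNω : ω₁ / ω₂ * Θ (ω₁ / ω₂) = jK a' / n₀ := by
      rw [map_div₀, div_mul_div_comm, hω₁, hω₂, mul_div_mul_left _ _ hc₀0]
    have hyb : n₀ * (ω₁ / ω₂ * Θ (ω₁ / ω₂)) = jK a' := by rw [hNω]; field_simp
    refine ⟨ω₁ / ω₂, hunit hNω (by rw [map_div₀, hb1, hn₀1, div_one]), ?_⟩
    have hN0 : ω₁ / ω₂ * Θ (ω₁ / ω₂) ≠ 0 := by rw [hNω]; exact div_ne_zero hb0 hn₀0
    have hρn₀0 : ρ n₀ ≠ 0 := (map_ne_zero ρ).2 hn₀0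
    have hre : κ * (ρ n₀ / n₀) * (ρ (ω₁ / ω₂ * Θ (ω₁ / ω₂)) / (ω₁ / ω₂ * Θ (ω₁ / ω₂))) =
        κ * (ρ (n₀ * (ω₁ / ω₂ * Θ (ω₁ / ω₂))) / (n₀ * (ω₁ / ω₂ * Θ (ω₁ / ω₂)))) := by
      rw [map_mul ρ n₀]; field_simp
    rw [hre]
    exact key (by rw [hyb]; exact hb0) (by rw [hyb]; exact hxb)

/-! ## §3 The threshold, exclusivity, agreement and constancy -/

/-- Products and quotients of `r`-approximants of `1` among units: `|a − 1| ≤ r`, `|b − 1| ≤ r`, `|b| = 1` ⇒ `|a∕b − 1| ≤ r` and `|ab − 1| ≤ r`. [cite: Serre1979, Ch. V §1] -/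
theorem v_div_sub_one_le_and_mul {a b : K} {r : ℤᵐ⁰} (ha : Valued.v (a - 1) ≤ r) (hb' : Valued.v (b - 1) ≤ r) (hb1 : Valued.v b = 1) :
    Valued.v (a / b - 1) ≤ r ∧ Valued.v (a * b - 1) ≤ r := by
  have hb0 : b ≠ 0 := fun h0 => by rw [h0, map_zero] at hb1; exact zero_ne_one hb1
  constructor
  · have h1 : a / b - 1 = ((a - 1) - (b - 1)) / b := by field_simp; ring
    rw [h1, map_div₀, hb1, div_one]
    exact (Valuation.map_sub _ _ _).trans (max_le ha hb')
  · have h1 : a * b - 1 = (a - 1) * b + (b - 1) := by ring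
    rw [h1]
    refine (Valuation.map_add _ _ _).trans (max_le ?_ hb')
    rw [map_mul, hb1, mul_one]; exact ha

/-- **THE THRESHOLD.**  For a `Θ`-fixed unit NON-norm `n₀`: `(∃ ω ∈ U_M, |ψ(n₀)·t(ω) − 1| ≤ |jK π′^{d′+k}|) ⟺ k + 2 ≤ dΘ` — below the threshold ★ p857465 §2 supplies a
non-norm `u ∈ Ṽ_k` and `n₀∕u` is a norm (index two); above it every element of `Ṽ_k` is a norm, so `n₀·N(ω) ∈ Ṽ_k` would make `n₀` a norm.
[cite: Serre1979, Ch. V §3 Cor. 3] -/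
theorem anchored_twist_near_iff_lt_threshold [CompleteSpace K] [Finite 𝓀[K]] (hvΘ : ∀ x, Valued.v (Θ x) = Valued.v x)
    (hσ' : ∀ x, σ' (σ' x) = x) (hvσ' : ∀ x, Valued.v (σ' x) = Valued.v x) (hfix' : ∀ x : K', σ' x = x → x ≠ 0 → ∃ n : ℤ, Valued.v x = exp (2 * n))
    (hπ' : Valued.v π' = exp (-1 : ℤ)) (hdd' : Valued.v (π' - σ' π') = Valued.v π' ^ d')
    (jK : K' →+* K) (hjle : ∀ x y : K', Valued.v (jK x) ≤ Valued.v (jK y) ↔ Valued.v x ≤ Valued.v y) (hjΘ : ∀ x, Θ (jK x) = jK x)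
    (hjfix : ∀ z : K, Θ z = z → ∃ x, jK x = z) (hjσ : ∀ x, jK (σ' x) = ρ (jK x)) (hjπ : Valued.v (jK π') = exp (-2 : ℤ))
    {ϖ : K} {dΘ tΘ : ℕ} (hDΘ : IsRamifiedQuadraticDatum Θ ϖ dΘ tΘ)
    (hFN : ∀ f : K, ρ f = f → Θ f = f → Valued.v f = 1 → ∃ x : K, x * Θ x = f)
    {n₀ : K} (hΘn₀ : Θ n₀ = n₀) (hn₀1 : Valued.v n₀ = 1) (hn₀N : ¬ ∃ z : K, z * Θ z = n₀) (k : ℕ) :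
    (∃ ω : K, Valued.v ω = 1 ∧ Valued.v (ρ n₀ / n₀ * (ρ (ω * Θ ω) / (ω * Θ ω)) - 1) ≤ Valued.v (jK π' ^ (d' + k))) ↔ k + 2 ≤ dΘ := by
  have hΘΘ := hDΘ.1
  have hn₀0 : n₀ ≠ 0 := fun h0 => by rw [h0, map_zero] at hn₀1; exact zero_ne_one hn₀1
  -- the anchored twist of `ω` is the twist of the `Θ`-fixed unit `v = n₀·N(ω)`: `|ψ(v) − 1| = |v − ρv|`
  have htw : ∀ {ω : K}, Valued.v ω = 1 →
      Θ (n₀ * (ω * Θ ω)) = n₀ * (ω * Θ ω) ∧ Valued.v (n₀ * (ω * Θ ω)) = 1 ∧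
        Valued.v (ρ n₀ / n₀ * (ρ (ω * Θ ω) / (ω * Θ ω)) - 1) = Valued.v (n₀ * (ω * Θ ω) - ρ (n₀ * (ω * Θ ω))) := fun {ω} hω => by
    have hω0 : ω ≠ 0 := fun h0 => by rw [h0, map_zero] at hω; exact zero_ne_one hω
    have hΘω0 : Θ ω ≠ 0 := (map_ne_zero Θ).2 hω0
    have hv1 : Valued.v (n₀ * (ω * Θ ω)) = 1 := by rw [map_mul, map_mul, hvΘ, hn₀1, hω, one_mul, one_mul]
    refine ⟨by rw [map_mul, hΘn₀, map_mul, hΘΘ, mul_comm (Θ ω)], hv1, ?_⟩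
    have h1 : ρ n₀ / n₀ * (ρ (ω * Θ ω) / (ω * Θ ω)) - 1 = (ρ (n₀ * (ω * Θ ω)) - n₀ * (ω * Θ ω)) / (n₀ * (ω * Θ ω)) := by
      rw [map_mul ρ n₀]; field_simp
    rw [h1, map_div₀, hv1, div_one, Valuation.map_sub_swap]
  constructor
  · rintro ⟨ω, hω, hle⟩
    obtain ⟨hΘv, hv1, heq⟩ := htw hω
    rw [heq] at hle
    by_contra hk
    have hk' : dΘ ≤ k + 1 := by omega
    obtain ⟨z, hz⟩ := exists_mul_map_eq_of_thetaFixed_depth_of_le hσ' hfix' hπ' hdd' jK hjle hjΘ hjfix hjσ hjπ hDΘ hFN hk' hΘv hv1 hle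
    -- `n₀ = N(z)∕N(ω) = N(z∕ω)`
    have hω0 : ω ≠ 0 := fun h0 => by rw [h0, map_zero] at hω; exact zero_ne_one hω
    refine hn₀N ⟨z / ω, ?_⟩
    rw [map_div₀, div_mul_div_comm, hz, mul_div_assoc, div_self (mul_ne_zero hω0 ((map_ne_zero Θ).2 hω0)), mul_one]
  · intro hk
    obtain ⟨u, hΘu, hu1, hud, huN⟩ := exists_thetaFixed_depth_not_norm_of_le hσ' hvσ' hfix' hπ' hdd' jK hjle hjfix hjσ hjπ hDΘ hk
    -- `n₀ ∕ u` is a norm: `n₀∕u = N(ω)`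
    obtain ⟨c₀, -, hc₀N, hdich⟩ := exists_nonnorm_dichotomy hDΘ
    have hc₀0 : c₀ ≠ 0 := fun h0 => hc₀N ⟨0, by rw [h0, zero_mul]⟩
    have hu0 : u ≠ 0 := fun h0 => by rw [h0, map_zero] at hu1; exact zero_ne_one hu1
    obtain ⟨ω₁, hω₁⟩ : ∃ z : K, z * Θ z = c₀ * u := (hdich u hΘu hu0).resolve_left huN
    obtain ⟨ω₂, hω₂⟩ : ∃ z : K, z * Θ z = c₀ * n₀ := (hdich n₀ hΘn₀ hn₀0).resolve_left hn₀N
    -- `ω := ω₁ ∕ ω₂` has `N(ω) = u∕n₀`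
    have hN : ω₁ / ω₂ * Θ (ω₁ / ω₂) = u / n₀ := by
      rw [map_div₀, div_mul_div_comm, hω₁, hω₂, mul_div_mul_left _ _ hc₀0]
    have hvω : Valued.v (ω₁ / ω₂) = 1 := v_eq_one_of_v_mul_map_eq_one hvΘ (by rw [hN, map_div₀, hu1, hn₀1, div_one])
    refine ⟨ω₁ / ω₂, hvω, ?_⟩
    obtain ⟨-, -, heq⟩ := htw hvω
    have hu' : n₀ * (ω₁ / ω₂ * Θ (ω₁ / ω₂)) = u := by rw [hN]; field_simp
    rw [heq, hu']
    exact hud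

/-- **EXCLUSIVITY BEYOND THE THRESHOLD**: if `dΘ ≤ k + 1` then `κ` is not in class T and class E at the same radius `|jK π′^{d′+k}|` (the quotient of the two witnesses
would be an anchored approximant, §3 threshold). [cite: Serre1979, Ch. V §3 Cor. 3] -/
theorem not_twist_near_and_anchored_of_threshold_le [CompleteSpace K] [Finite 𝓀[K]]
    (hvρ : ∀ x, Valued.v (ρ x) = Valued.v x) (hvΘ : ∀ x, Valued.v (Θ x) = Valued.v x)
    (hσ' : ∀ x, σ' (σ' x) = x) (hvσ' : ∀ x, Valued.v (σ' x) = Valued.v x) (hfix' : ∀ x : K', σ' x = x → x ≠ 0 → ∃ n : ℤ, Valued.v x = exp (2 * n))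
    (hπ' : Valued.v π' = exp (-1 : ℤ)) (hdd' : Valued.v (π' - σ' π') = Valued.v π' ^ d')
    (jK : K' →+* K) (hjle : ∀ x y : K', Valued.v (jK x) ≤ Valued.v (jK y) ↔ Valued.v x ≤ Valued.v y) (hjΘ : ∀ x, Θ (jK x) = jK x)
    (hjfix : ∀ z : K, Θ z = z → ∃ x, jK x = z) (hjσ : ∀ x, jK (σ' x) = ρ (jK x)) (hjπ : Valued.v (jK π') = exp (-2 : ℤ))
    {ϖ : K} {dΘ tΘ : ℕ} (hDΘ : IsRamifiedQuadraticDatum Θ ϖ dΘ tΘ)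
    (hFN : ∀ f : K, ρ f = f → Θ f = f → Valued.v f = 1 → ∃ x : K, x * Θ x = f)
    {n₀ : K} (hΘn₀ : Θ n₀ = n₀) (hn₀1 : Valued.v n₀ = 1) (hn₀N : ¬ ∃ z : K, z * Θ z = n₀) {k : ℕ} (hk : dΘ ≤ k + 1)
    {κ : K} (hκ1 : Valued.v κ = 1) :
    ¬ ((∃ ω : K, Valued.v ω = 1 ∧ Valued.v (κ * (ρ (ω * Θ ω) / (ω * Θ ω)) - 1) ≤ Valued.v (jK π' ^ (d' + k))) ∧
       ∃ ω : K, Valued.v ω = 1 ∧ Valued.v (κ * (ρ n₀ / n₀) * (ρ (ω * Θ ω) / (ω * Θ ω)) - 1) ≤ Valued.v (jK π' ^ (d' + k))) := by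
  rintro ⟨⟨ω₁, hω₁, h₁⟩, ⟨ω₂, hω₂, h₂⟩⟩
  have hω₁0 : ω₁ ≠ 0 := fun h0 => by rw [h0, map_zero] at hω₁; exact zero_ne_one hω₁
  have hω₂0 : ω₂ ≠ 0 := fun h0 => by rw [h0, map_zero] at hω₂; exact zero_ne_one hω₂
  have hκ0 : κ ≠ 0 := fun h0 => by rw [h0, map_zero] at hκ1; exact zero_ne_one hκ1
  have ht₁ : Valued.v (κ * (ρ (ω₁ * Θ ω₁) / (ω₁ * Θ ω₁))) = 1 := by rw [map_mul, hκ1, v_normTwist_eq_one hvρ hω₁0, mul_one]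
  -- the quotient witness `ω₂ ∕ ω₁`
  obtain ⟨hq, -⟩ := v_div_sub_one_le_and_mul h₂ h₁ ht₁
  have hlt := (anchored_twist_near_iff_lt_threshold hvΘ hσ' hvσ' hfix' hπ' hdd' jK hjle hjΘ hjfix hjσ hjπ hDΘ hFN hΘn₀ hn₀1 hn₀N k).1
    ⟨ω₂ / ω₁, by rw [map_div₀, hω₁, hω₂, div_one], by
      have hre : ρ n₀ / n₀ * (ρ (ω₂ / ω₁ * Θ (ω₂ / ω₁)) / (ω₂ / ω₁ * Θ (ω₂ / ω₁))) =
          κ * (ρ n₀ / n₀) * (ρ (ω₂ * Θ ω₂) / (ω₂ * Θ ω₂)) / (κ * (ρ (ω₁ * Θ ω₁) / (ω₁ * Θ ω₁))) := by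
        rw [div_eq_mul_inv ω₂, normTwist_mul_inv hω₂0 hω₁0]
        have hn : ρ n₀ ≠ 0 := (map_ne_zero ρ).2 (fun h0 => by rw [h0, map_zero] at hn₀1; exact zero_ne_one hn₀1)
        have hn' : n₀ ≠ 0 := fun h0 => by rw [h0, map_zero] at hn₀1; exact zero_ne_one hn₀1
        have hN₁ : ω₁ * Θ ω₁ ≠ 0 := mul_ne_zero hω₁0 ((map_ne_zero Θ).2 hω₁0)
        have hρN₁ : ρ (ω₁ * Θ ω₁) ≠ 0 := (map_ne_zero ρ).2 hN₁
        field_simp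
      rw [hre]; exact hq⟩
  omega

/-- **AGREEMENT BELOW THE THRESHOLD**: if `k + 2 ≤ dΘ` then classes T and E coincide at radius `|jK π′^{d′+k}|` (multiply ∕ divide the witness by the anchored approximant of
§3 threshold). [cite: Serre1979, Ch. V §3 Cor. 3] -/
theorem twist_near_iff_anchored_of_lt_threshold [CompleteSpace K] [Finite 𝓀[K]]
    (hvρ : ∀ x, Valued.v (ρ x) = Valued.v x) (hvΘ : ∀ x, Valued.v (Θ x) = Valued.v x)
    (hσ' : ∀ x, σ' (σ' x) = x) (hvσ' : ∀ x, Valued.v (σ' x) = Valued.v x) (hfix' : ∀ x : K', σ' x = x → x ≠ 0 → ∃ n : ℤ, Valued.v x = exp (2 * n))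
    (hπ' : Valued.v π' = exp (-1 : ℤ)) (hdd' : Valued.v (π' - σ' π') = Valued.v π' ^ d')
    (jK : K' →+* K) (hjle : ∀ x y : K', Valued.v (jK x) ≤ Valued.v (jK y) ↔ Valued.v x ≤ Valued.v y) (hjΘ : ∀ x, Θ (jK x) = jK x)
    (hjfix : ∀ z : K, Θ z = z → ∃ x, jK x = z) (hjσ : ∀ x, jK (σ' x) = ρ (jK x)) (hjπ : Valued.v (jK π') = exp (-2 : ℤ))
    {ϖ : K} {dΘ tΘ : ℕ} (hDΘ : IsRamifiedQuadraticDatum Θ ϖ dΘ tΘ)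
    (hFN : ∀ f : K, ρ f = f → Θ f = f → Valued.v f = 1 → ∃ x : K, x * Θ x = f)
    {n₀ : K} (hΘn₀ : Θ n₀ = n₀) (hn₀1 : Valued.v n₀ = 1) (hn₀N : ¬ ∃ z : K, z * Θ z = n₀) {k : ℕ} (hk : k + 2 ≤ dΘ)
    (κ : K) :
    (∃ ω : K, Valued.v ω = 1 ∧ Valued.v (κ * (ρ (ω * Θ ω) / (ω * Θ ω)) - 1) ≤ Valued.v (jK π' ^ (d' + k))) ↔
      ∃ ω : K, Valued.v ω = 1 ∧ Valued.v (κ * (ρ n₀ / n₀) * (ρ (ω * Θ ω) / (ω * Θ ω)) - 1) ≤ Valued.v (jK π' ^ (d' + k)) := by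
  obtain ⟨ω₀, hω₀, h₀⟩ := (anchored_twist_near_iff_lt_threshold hvΘ hσ' hvσ' hfix' hπ' hdd' jK hjle hjΘ hjfix hjσ hjπ hDΘ hFN hΘn₀ hn₀1 hn₀N k).2 hk
  have hω₀0 : ω₀ ≠ 0 := fun h0 => by rw [h0, map_zero] at hω₀; exact zero_ne_one hω₀
  have hn₀0 : n₀ ≠ 0 := fun h0 => by rw [h0, map_zero] at hn₀1; exact zero_ne_one hn₀1
  have hρn₀0 : ρ n₀ ≠ 0 := (map_ne_zero ρ).2 hn₀0
  have hψn₀ : Valued.v (ρ n₀ / n₀) = 1 := by rw [map_div₀, hvρ, div_self ((Valuation.ne_zero_iff _).2 hn₀0)]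
  have ha₀ : Valued.v (ρ n₀ / n₀ * (ρ (ω₀ * Θ ω₀) / (ω₀ * Θ ω₀))) = 1 := by rw [map_mul, hψn₀, v_normTwist_eq_one hvρ hω₀0, one_mul]
  constructor
  · rintro ⟨ω₁, hω₁, h₁⟩
    have hω₁0 : ω₁ ≠ 0 := fun h0 => by rw [h0, map_zero] at hω₁; exact zero_ne_one hω₁
    refine ⟨ω₁ * ω₀, by rw [map_mul, hω₁, hω₀, mul_one], ?_⟩
    obtain ⟨-, hmul⟩ := v_div_sub_one_le_and_mul h₁ h₀ ha₀
    have hre : κ * (ρ n₀ / n₀) * (ρ (ω₁ * ω₀ * Θ (ω₁ * ω₀)) / (ω₁ * ω₀ * Θ (ω₁ * ω₀))) =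
        κ * (ρ (ω₁ * Θ ω₁) / (ω₁ * Θ ω₁)) * (ρ n₀ / n₀ * (ρ (ω₀ * Θ ω₀) / (ω₀ * Θ ω₀))) := by
      rw [normTwist_mul hω₁0 hω₀0]; ring
    rw [hre]; exact hmul
  · rintro ⟨ω₂, hω₂, h₂⟩
    have hω₂0 : ω₂ ≠ 0 := fun h0 => by rw [h0, map_zero] at hω₂; exact zero_ne_one hω₂
    refine ⟨ω₂ / ω₀, by rw [map_div₀, hω₂, hω₀, div_one], ?_⟩
    obtain ⟨hdiv, -⟩ := v_div_sub_one_le_and_mul h₂ h₀ ha₀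
    have hN₀ : ω₀ * Θ ω₀ ≠ 0 := mul_ne_zero hω₀0 ((map_ne_zero Θ).2 hω₀0)
    have hρN₀ : ρ (ω₀ * Θ ω₀) ≠ 0 := (map_ne_zero ρ).2 hN₀
    have hre : κ * (ρ (ω₂ / ω₀ * Θ (ω₂ / ω₀)) / (ω₂ / ω₀ * Θ (ω₂ / ω₀))) =
        κ * (ρ n₀ / n₀) * (ρ (ω₂ * Θ ω₂) / (ω₂ * Θ ω₂)) / (ρ n₀ / n₀ * (ρ (ω₀ * Θ ω₀) / (ω₀ * Θ ω₀))) := by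
      rw [div_eq_mul_inv ω₂, normTwist_mul_inv hω₂0 hω₀0]
      field_simp
    rw [hre]; exact hdiv

/-- **CONSTANCY ALONG THE DIAGONAL (class T)**: beyond the threshold (`dΘ ≤ k₁ + 1`), if `κ` is in class T at radius `|jK π′^{d′+k₁}|` and is in class T or class E at a
deeper radius `|jK π′^{d′+k₂}|`, `k₁ ≤ k₂`, then it is in class T there (else class E at `k₂`, hence at `k₁`, contradicting exclusivity). [cite: Serre1979, Ch. V §3 Cor. 3] -/
theorem twist_near_of_twist_near_of_near [CompleteSpace K] [Finite 𝓀[K]]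
    (hvρ : ∀ x, Valued.v (ρ x) = Valued.v x) (hvΘ : ∀ x, Valued.v (Θ x) = Valued.v x)
    (hσ' : ∀ x, σ' (σ' x) = x) (hvσ' : ∀ x, Valued.v (σ' x) = Valued.v x) (hfix' : ∀ x : K', σ' x = x → x ≠ 0 → ∃ n : ℤ, Valued.v x = exp (2 * n))
    (hπ' : Valued.v π' = exp (-1 : ℤ)) (hdd' : Valued.v (π' - σ' π') = Valued.v π' ^ d')
    (jK : K' →+* K) (hjle : ∀ x y : K', Valued.v (jK x) ≤ Valued.v (jK y) ↔ Valued.v x ≤ Valued.v y) (hjΘ : ∀ x, Θ (jK x) = jK x)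
    (hjfix : ∀ z : K, Θ z = z → ∃ x, jK x = z) (hjσ : ∀ x, jK (σ' x) = ρ (jK x)) (hjπ : Valued.v (jK π') = exp (-2 : ℤ))
    {ϖ : K} {dΘ tΘ : ℕ} (hDΘ : IsRamifiedQuadraticDatum Θ ϖ dΘ tΘ)
    (hFN : ∀ f : K, ρ f = f → Θ f = f → Valued.v f = 1 → ∃ x : K, x * Θ x = f)
    {n₀ : K} (hΘn₀ : Θ n₀ = n₀) (hn₀1 : Valued.v n₀ = 1) (hn₀N : ¬ ∃ z : K, z * Θ z = n₀) {k₁ k₂ : ℕ} (hk₁ : dΘ ≤ k₁ + 1) (hk : k₁ ≤ k₂)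
    {κ : K} (hκ1 : Valued.v κ = 1)
    (h₁ : ∃ ω : K, Valued.v ω = 1 ∧ Valued.v (κ * (ρ (ω * Θ ω) / (ω * Θ ω)) - 1) ≤ Valued.v (jK π' ^ (d' + k₁)))
    (h₂ : (∃ ω : K, Valued.v ω = 1 ∧ Valued.v (κ * (ρ (ω * Θ ω) / (ω * Θ ω)) - 1) ≤ Valued.v (jK π' ^ (d' + k₂))) ∨
      ∃ ω : K, Valued.v ω = 1 ∧ Valued.v (κ * (ρ n₀ / n₀) * (ρ (ω * Θ ω) / (ω * Θ ω)) - 1) ≤ Valued.v (jK π' ^ (d' + k₂))) :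
    ∃ ω : K, Valued.v ω = 1 ∧ Valued.v (κ * (ρ (ω * Θ ω) / (ω * Θ ω)) - 1) ≤ Valued.v (jK π' ^ (d' + k₂)) := by
  rcases h₂ with h₂ | ⟨ω, hω, h₂⟩
  · exact h₂
  · exfalso
    have hmono : Valued.v (jK π' ^ (d' + k₂)) ≤ Valued.v (jK π' ^ (d' + k₁)) := by
      rw [map_pow, map_pow, hjπ, ← exp_nsmul, ← exp_nsmul, nsmul_eq_mul, nsmul_eq_mul, exp_le_exp]; push_cast; omega
    exact not_twist_near_and_anchored_of_threshold_le hvρ hvΘ hσ' hvσ' hfix' hπ' hdd' jK hjle hjΘ hjfix hjσ hjπ hDΘ hFN hΘn₀ hn₀1 hn₀N hk₁ hκ1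
      ⟨h₁, ω, hω, h₂.trans hmono⟩

/-- **CONSTANCY ALONG THE DIAGONAL (class E)**: the mirror statement. [cite: Serre1979, Ch. V §3 Cor. 3] -/
theorem anchored_of_anchored_of_near [CompleteSpace K] [Finite 𝓀[K]]
    (hvρ : ∀ x, Valued.v (ρ x) = Valued.v x) (hvΘ : ∀ x, Valued.v (Θ x) = Valued.v x)
    (hσ' : ∀ x, σ' (σ' x) = x) (hvσ' : ∀ x, Valued.v (σ' x) = Valued.v x) (hfix' : ∀ x : K', σ' x = x → x ≠ 0 → ∃ n : ℤ, Valued.v x = exp (2 * n))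
    (hπ' : Valued.v π' = exp (-1 : ℤ)) (hdd' : Valued.v (π' - σ' π') = Valued.v π' ^ d')
    (jK : K' →+* K) (hjle : ∀ x y : K', Valued.v (jK x) ≤ Valued.v (jK y) ↔ Valued.v x ≤ Valued.v y) (hjΘ : ∀ x, Θ (jK x) = jK x)
    (hjfix : ∀ z : K, Θ z = z → ∃ x, jK x = z) (hjσ : ∀ x, jK (σ' x) = ρ (jK x)) (hjπ : Valued.v (jK π') = exp (-2 : ℤ))
    {ϖ : K} {dΘ tΘ : ℕ} (hDΘ : IsRamifiedQuadraticDatum Θ ϖ dΘ tΘ)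
    (hFN : ∀ f : K, ρ f = f → Θ f = f → Valued.v f = 1 → ∃ x : K, x * Θ x = f)
    {n₀ : K} (hΘn₀ : Θ n₀ = n₀) (hn₀1 : Valued.v n₀ = 1) (hn₀N : ¬ ∃ z : K, z * Θ z = n₀) {k₁ k₂ : ℕ} (hk₁ : dΘ ≤ k₁ + 1) (hk : k₁ ≤ k₂)
    {κ : K} (hκ1 : Valued.v κ = 1)
    (h₁ : ∃ ω : K, Valued.v ω = 1 ∧ Valued.v (κ * (ρ n₀ / n₀) * (ρ (ω * Θ ω) / (ω * Θ ω)) - 1) ≤ Valued.v (jK π' ^ (d' + k₁)))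
    (h₂ : (∃ ω : K, Valued.v ω = 1 ∧ Valued.v (κ * (ρ (ω * Θ ω) / (ω * Θ ω)) - 1) ≤ Valued.v (jK π' ^ (d' + k₂))) ∨
      ∃ ω : K, Valued.v ω = 1 ∧ Valued.v (κ * (ρ n₀ / n₀) * (ρ (ω * Θ ω) / (ω * Θ ω)) - 1) ≤ Valued.v (jK π' ^ (d' + k₂))) :
    ∃ ω : K, Valued.v ω = 1 ∧ Valued.v (κ * (ρ n₀ / n₀) * (ρ (ω * Θ ω) / (ω * Θ ω)) - 1) ≤ Valued.v (jK π' ^ (d' + k₂)) := by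
  rcases h₂ with ⟨ω, hω, h₂⟩ | h₂
  · exfalso
    have hmono : Valued.v (jK π' ^ (d' + k₂)) ≤ Valued.v (jK π' ^ (d' + k₁)) := by
      rw [map_pow, map_pow, hjπ, ← exp_nsmul, ← exp_nsmul, nsmul_eq_mul, nsmul_eq_mul, exp_le_exp]; push_cast; omega
    exact not_twist_near_and_anchored_of_threshold_le hvρ hvΘ hσ' hvσ' hfix' hπ' hdd' jK hjle hjΘ hjfix hjσ hjπ hDΘ hFN hΘn₀ hn₀1 hn₀N hk₁ hκ1
      ⟨⟨ω, hω, h₂.trans hmono⟩, h₁⟩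
  · exact h₂

end Summit.HodgeConjecture.HodgeConjecture.Cruxes.H413.F0P3cDyRamToricLevelCensusRamM

end
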